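import Summits.CriticalPhenomena.Ising3DConformalLimit.Theorems.InversionUpgradeNormalised.Negative.AutomaticOrders
import Summits.CriticalPhenomena.Ising3DConformalLimit.Theorems.IsingEuclidUpgradeRefutations

/-!
# `InversionUpgradeNormalised` (item stmt-CriticalPhenomena-1982): load-bearing hypotheses and tight guards

Negative knowledge about the crux
`Summit.CriticalPhenomena.Ising3DConformalLimit.Theses.HyperoctahedralRP.InversionUpgradeNormalised`
(standing crux disprover, cycles 1–2, D-0016), hypotheses (H1)–(H6) as in
`Negative/AutomaticOrders.lean`:

* LOAD-BEARING. (H2) cannot be dropped at ANY `Δ > 0` (`not_cruxWithoutIsingLimit`, barrier witness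
  `ScaleNotMoebius.narrowFamily`; its weakening to generic lattice provenance is the tree theorem
  `Literature.Barriers.CriticalPhenomena.not_inversionUpgrade_of_latticeLimit_at`); (H3) cannot be
  dropped given `CritIsing3DEuclideanLimit` (tree `IsingEuclidUpgrade.not_inversionUpgrade_of_euclideanLimit`,
  re-exported as `not_cruxWithoutNormalisation`); (H6) cannot be dropped given
  `CritIsing3DEuclideanLimit` (`not_cruxWithoutScaleCovariance`: it is what binds `Δ`); (H1) is
  sign-insensitive (`hasPointwiseScalingLimit_abs_iff`); the hypotheses are jointly satisfiable as
  soon as the Euclidean limit exists (`exists_hyp_of_euclideanLimit`).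
* TIGHT GUARDS. The origin guard of `IsInversionCovariant` is necessary (`not_unguarded`,
  `not_cruxUnguarded`: Mathlib's `inversion 0 1 0 = 0`); the weight of the conclusion is forced
  (`inversion_weight_eq`: covariance with any weight `Δ'` under (H3)–(H6) gives `Δ' = Δ`).

Theorem-only file (no new definitions).
-/

noncomputable section

namespace Summit.CriticalPhenomena.Ising3DConformalLimit.InversionUpgradeNormalisedNegative

open Literature.Probability.LatticeModels Literature.Barriers.CriticalPhenomena
open Filter Set Function EuclideanGeometry
open scoped Topology

/-! ## Load-bearing hypotheses -/

/-- **(H2) is load-bearing at EVERY `Δ > 0`**: the crux with the lattice clause deleted is false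
(barrier witness `ScaleNotMoebius.narrowFamily Δ` has (H3)–(H6) and is not inversion covariant).
[folklore] -/
theorem not_cruxWithoutIsingLimit {Δ : ℝ} (hΔ : 0 < Δ) :
    ¬ ∀ S : CorrFamily 3, (∀ n z, z ∉ NonCoincident 3 n → S n z = 0) → IsNondegenerateTwoPoint S →
      IsEuclideanInvariant S → IsScaleCovariant Δ S → IsInversionCovariant Δ S := fun h =>
  ScaleNotMoebius.narrowFamily_not_isInversionCovariant hΔ
    (h _ (ScaleNotMoebius.narrowFamily_eq_zero_of_not_mem hΔ.ne')
      (ScaleNotMoebius.narrowFamily_isNondegenerateTwoPoint Δ)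
      (ScaleNotMoebius.narrowFamily_isEuclideanInvariant Δ) (ScaleNotMoebius.narrowFamily_isScaleCovariant Δ))

/-- Normalising a family off `NonCoincident` keeps limit, non-degeneracy, Euclidean invariance and
scale covariance: the Euclidean limit (item 0638) yields an instance of ALL six hypotheses of the
crux (so the hypotheses are satisfiable as soon as `CritIsing3DEuclideanLimit` holds). [folklore] -/
theorem exists_hyp_of_euclideanLimit (hE : CritIsing3DEuclideanLimit) :
    ∃ (ρ : ℝ → ℝ) (Δ : ℝ) (S : CorrFamily 3), (∀ δ ∈ Set.Ioc (0:ℝ) 1, 0 < ρ δ) ∧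
      HasPointwiseScalingLimit (criticalCorr 3) ρ S ∧ (∀ n z, z ∉ NonCoincident 3 n → S n z = 0) ∧
      IsNondegenerateTwoPoint S ∧ IsEuclideanInvariant S ∧ IsScaleCovariant Δ S := by
  classical
  obtain ⟨ρ, Δ, S₀, hρ, _, hlim, hnd, heuc, hsc⟩ := hE
  let S : CorrFamily 3 := fun n z => if Function.Injective z then S₀ n z else 0
  have S_of_inj : ∀ {n : ℕ} {z : Fin n → EuclideanSpace ℝ (Fin 3)}, Function.Injective z → S n z = S₀ n z :=
    fun hz => by simp [S, hz]
  have S_of_not : ∀ {n : ℕ} {z : Fin n → EuclideanSpace ℝ (Fin 3)}, ¬ Function.Injective z → S n z = 0 :=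
    fun hz => by simp [S, hz]
  refine ⟨ρ, Δ, S, hρ, ?_, ?_, ?_, ?_, ?_⟩
  · exact fun n => (hlim n).congr_right fun z hz => (S_of_inj hz).symm
  · intro n z hz; exact S_of_not hz
  · intro z hz; rw [S_of_inj hz]; exact hnd z hz
  · refine ⟨fun n v z => ?_, fun n R z => ?_⟩
    · by_cases hz : Function.Injective z
      · have hz' : Function.Injective (fun i => z i + v) := (add_left_injective v).comp hz
        rw [S_of_inj hz, S_of_inj hz', heuc.1 n v z]
      · have hz' : ¬ Function.Injective (fun i => z i + v) :=
          fun h => hz ((add_left_injective v).of_comp_iff _ |>.1 h)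
        rw [S_of_not hz, S_of_not hz']
    · by_cases hz : Function.Injective z
      · have hz' : Function.Injective (fun i => R (z i)) := R.injective.comp hz
        rw [S_of_inj hz, S_of_inj hz', heuc.2 n R z]
      · have hz' : ¬ Function.Injective (fun i => R (z i)) :=
          fun h => hz (R.injective.of_comp_iff _ |>.1 h)
        rw [S_of_not hz, S_of_not hz']
  · intro n c hc z
    by_cases hz : Function.Injective z
    · have hz' : Function.Injective (fun i => c • z i) := (smul_right_injective _ hc.ne').comp hz
      rw [S_of_inj hz, S_of_inj hz', hsc n c hc z]
    · have hz' : ¬ Function.Injective (fun i => c • z i) :=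
        fun h => hz ((smul_right_injective _ hc.ne').of_comp_iff _ |>.1 h)
      rw [S_of_not hz, S_of_not hz', mul_zero]

/-- Inversion covariance at `n = 2` with TWO weights contradicts non-degeneracy: at `(e₀, 2e₀)` the
two laws give `2^{2Δ} S₂ = 2^{2Δ'} S₂` with `S₂ > 0`. [folklore] -/
theorem weight_unique_of_two {Δ Δ' : ℝ} {S : CorrFamily 3} (hnd : IsNondegenerateTwoPoint S)
    (h : ∀ x : Fin 2 → EuclideanSpace ℝ (Fin 3), (∀ i, x i ≠ 0) →
      S 2 (fun i => inversion 0 1 (x i)) = (∏ i, ‖x i‖ ^ (2 * Δ)) * S 2 x)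
    (h' : ∀ x : Fin 2 → EuclideanSpace ℝ (Fin 3), (∀ i, x i ≠ 0) →
      S 2 (fun i => inversion 0 1 (x i)) = (∏ i, ‖x i‖ ^ (2 * Δ')) * S 2 x) : Δ = Δ' := by
  set e : EuclideanSpace ℝ (Fin 3) := EuclideanSpace.single 0 1 with he
  have hne : ‖e‖ = 1 := by simp [he]
  have he0 : e ≠ 0 := by rw [← norm_ne_zero_iff, hne]; exact one_ne_zero
  have hne2 : e ≠ (2:ℝ) • e := by
    intro hh
    have : (1:ℝ) • e = (2:ℝ) • e := by simpa using hh
    exact absurd (smul_left_injective ℝ he0 this) (by norm_num)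
  let x : Fin 2 → EuclideanSpace ℝ (Fin 3) := ![e, (2:ℝ) • e]
  have hx0 : ∀ i, x i ≠ 0 := by
    intro i; fin_cases i
    · exact he0
    · exact smul_ne_zero two_ne_zero he0
  have hxinj : Function.Injective x := by
    intro i j hij
    fin_cases i <;> fin_cases j
    · rfl
    · exact absurd hij hne2
    · exact absurd hij.symm hne2
    · rfl
  have hpos : 0 < S 2 x := hnd x hxinj
  have hprod : (∏ i, ‖x i‖ ^ (2 * Δ)) = (2:ℝ) ^ (2 * Δ) := by
    simp [x, Fin.prod_univ_two, norm_smul, hne]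
  have hprod' : (∏ i, ‖x i‖ ^ (2 * Δ')) = (2:ℝ) ^ (2 * Δ') := by
    simp [x, Fin.prod_univ_two, norm_smul, hne]
  have h1 := h x hx0
  have h2 := h' x hx0
  rw [hprod] at h1
  rw [hprod'] at h2
  have heq : (2:ℝ) ^ (2 * Δ) = (2:ℝ) ^ (2 * Δ') := mul_right_cancel₀ hpos.ne' (h1.symm.trans h2)
  have hl := congrArg Real.log heq
  rw [Real.log_rpow two_pos, Real.log_rpow two_pos] at hl
  have hlog : Real.log 2 ≠ 0 := by positivity
  have := mul_right_cancel₀ hlog hl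
  linarith

/-- **(H6) is load-bearing, given satisfiability of the hypotheses** (`CritIsing3DEuclideanLimit`):
with scale covariance deleted `Δ` is a free parameter of the conclusion, which would then hold for
`Δ` and `Δ + 1` simultaneously — contradicting `weight_unique_of_two`. [folklore] -/
theorem not_cruxWithoutScaleCovariance (hE : CritIsing3DEuclideanLimit) :
    ¬ ∀ (ρ : ℝ → ℝ) (Δ : ℝ) (S : CorrFamily 3), (∀ δ ∈ Set.Ioc (0:ℝ) 1, 0 < ρ δ) →
      HasPointwiseScalingLimit (criticalCorr 3) ρ S → (∀ n z, z ∉ NonCoincident 3 n → S n z = 0) →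
      IsNondegenerateTwoPoint S → IsEuclideanInvariant S → IsInversionCovariant Δ S := by
  intro h
  obtain ⟨ρ, Δ, S, hρ, hlim, hnorm, hnd, heuc, _⟩ := exists_hyp_of_euclideanLimit hE
  have h1 := h ρ Δ S hρ hlim hnorm hnd heuc
  have h2 := h ρ (Δ + 1) S hρ hlim hnorm hnd heuc
  have := weight_unique_of_two hnd (h1 2) (h2 2)
  linarith

/-- (H3) is load-bearing given `CritIsing3DEuclideanLimit`: the un-normalised statement (item 0637)
is refuted in tree; re-exported here in the notation of this file. [folklore] -/
theorem not_cruxWithoutNormalisation (hE : CritIsing3DEuclideanLimit) :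
    ¬ ∀ (ρ : ℝ → ℝ) (Δ : ℝ) (S : CorrFamily 3), (∀ δ ∈ Set.Ioc (0:ℝ) 1, 0 < ρ δ) →
      HasPointwiseScalingLimit (criticalCorr 3) ρ S → IsNondegenerateTwoPoint S →
      IsEuclideanInvariant S → IsScaleCovariant Δ S → IsInversionCovariant Δ S :=
  Summit.CriticalPhenomena.IsingEuclidUpgrade.not_inversionUpgrade_of_euclideanLimit hE

/-- (H1) up to sign: the renormalisation enters only through `ρ(δ)ⁿ` with `n` even (odd critical
correlators vanish on `ℤ³`), so `ρ` and `|ρ|` give the same rescaled family. [folklore] -/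
theorem rescaledCorrelator_abs (ρ : ℝ → ℝ) (n : ℕ) (δ : ℝ) (x : Fin n → EuclideanSpace ℝ (Fin 3)) :
    rescaledCorrelator (criticalCorr 3) (fun δ => |ρ δ|) n δ x = rescaledCorrelator (criticalCorr 3) ρ n δ x := by
  rw [rescaledCorrelator_apply, rescaledCorrelator_apply]
  rcases Nat.even_or_odd n with hev | hodd
  · rw [hev.pow_abs]
  · rw [criticalCorr_eq_zero_of_odd (d := 3) le_rfl hodd, mul_zero, mul_zero]

/-- So (H2) is insensitive to the sign of `ρ` ("(H1) possibly unnecessary": the positivity half of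
(H1) carries no information beyond `ρ δ ≠ 0` for small `δ`, which (H2)+(H4) force anyway). [folklore] -/
theorem hasPointwiseScalingLimit_abs_iff (ρ : ℝ → ℝ) (S : CorrFamily 3) :
    HasPointwiseScalingLimit (criticalCorr 3) (fun δ => |ρ δ|) S ↔ HasPointwiseScalingLimit (criticalCorr 3) ρ S := by
  have : rescaledCorrelator (criticalCorr 3) (fun δ => |ρ δ|) = rescaledCorrelator (criticalCorr 3) ρ := by
    funext n δ x; exact rescaledCorrelator_abs ρ n δ x
  simp only [HasPointwiseScalingLimit, this]

/-! ## The guards of the conclusion are tight -/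

/-- **The origin guard of `IsInversionCovariant` is necessary**: Mathlib's `inversion 0 1 0 = 0`, so
at `(0, e₀)` the unguarded law reads `S₂(0,e₀) = 0^{2Δ}·S₂(0,e₀) = 0`, contradicting
non-degeneracy — for EVERY non-degenerate family and every `Δ > 0`. [folklore] -/
theorem not_unguarded {Δ : ℝ} (hΔ : 0 < Δ) {S : CorrFamily 3} (hnd : IsNondegenerateTwoPoint S) :
    ¬ ∀ n (x : Fin n → EuclideanSpace ℝ (Fin 3)),
      S n (fun i => inversion 0 1 (x i)) = (∏ i, ‖x i‖ ^ (2 * Δ)) * S n x := by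
  intro h
  set e : EuclideanSpace ℝ (Fin 3) := EuclideanSpace.single 0 1 with he
  have hne : ‖e‖ = 1 := by simp [he]
  have he0 : e ≠ 0 := by rw [← norm_ne_zero_iff, hne]; exact one_ne_zero
  let x : Fin 2 → EuclideanSpace ℝ (Fin 3) := ![0, e]
  have hxinj : Function.Injective x := by
    intro i j hij
    fin_cases i <;> fin_cases j
    · rfl
    · exact absurd hij (Ne.symm he0)
    · exact absurd hij he0
    · rfl
  have hpos : 0 < S 2 x := hnd x hxinj
  have hinv_e : inversion (0 : EuclideanSpace ℝ (Fin 3)) 1 e = e := by simp [inversion, hne]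
  have hinv : (fun i => inversion (0 : EuclideanSpace ℝ (Fin 3)) 1 (x i)) = x := by
    funext i; fin_cases i
    · simp [x]
    · simp [x, hinv_e]
  have hprod : (∏ i, ‖x i‖ ^ (2 * Δ)) = 0 := by
    rw [Fin.prod_univ_two]
    simp [x, Real.zero_rpow (by positivity : (2 * Δ) ≠ 0)]
  have := h 2 x
  rw [hinv, hprod, zero_mul] at this
  exact absurd this hpos.ne'

/-- So the crux with the UNGUARDED conclusion is false as soon as its hypotheses are satisfiable. [folklore] -/
theorem not_cruxUnguarded (hE : CritIsing3DEuclideanLimit) :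
    ¬ ∀ (ρ : ℝ → ℝ) (Δ : ℝ) (S : CorrFamily 3), (∀ δ ∈ Set.Ioc (0:ℝ) 1, 0 < ρ δ) →
      HasPointwiseScalingLimit (criticalCorr 3) ρ S → (∀ n z, z ∉ NonCoincident 3 n → S n z = 0) →
      IsNondegenerateTwoPoint S → IsEuclideanInvariant S → IsScaleCovariant Δ S →
      ∀ n (x : Fin n → EuclideanSpace ℝ (Fin 3)),
        S n (fun i => inversion 0 1 (x i)) = (∏ i, ‖x i‖ ^ (2 * Δ)) * S n x := by
  intro h
  obtain ⟨ρ, Δ, S, hρ, hlim, hnorm, hnd, heuc, hsc⟩ := exists_hyp_of_euclideanLimit hE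
  have hΔ : 0 < Δ := by linarith [(delta_mem_Icc_of_hyp hρ hlim hnd hsc).1]
  exact not_unguarded hΔ hnd (h ρ Δ S hρ hlim hnorm hnd heuc hsc)

/-- **The weight of the conclusion is forced** (model-blind, under (H3)–(H6)): if `S` is inversion
covariant with ANY weight `Δ'` then `Δ' = Δ`; so the conclusion cannot be shifted to another
exponent, and a line proving covariance "for some weight" proves it for `Δ`. [folklore] -/
theorem inversion_weight_eq {Δ Δ' : ℝ} {S : CorrFamily 3}
    (hnorm : ∀ n z, z ∉ NonCoincident 3 n → S n z = 0) (hnd : IsNondegenerateTwoPoint S)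
    (heuc : IsEuclideanInvariant S) (hsc : IsScaleCovariant Δ S) (hinv : IsInversionCovariant Δ' S) :
    Δ' = Δ :=
  (weight_unique_of_two hnd (invIdentity_two hnorm heuc hsc) (hinv 2)).symm

end Summit.CriticalPhenomena.Ising3DConformalLimit.InversionUpgradeNormalisedNegative

end
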